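import Literature.AlgebraicGeometry.Motives.Varieties
import Mathlib.AlgebraicGeometry.Morphisms.Flat
import Mathlib.Algebra.Category.Ring.Constructions
import HarnessLib

/-!
# Sections of `P ×_K Spec R` over an affine open of `P ×_K T`: the model `Γ(V) ⊗_{Γ(B)} R`

Let `K` be a field, `P` and `T` schemes over `K`, `B ⊆ T` an affine open with ring
`Λ = Γ(B, 𝒪_T)` and `R` a `Λ`-algebra, giving the `K`-scheme
`Spec R → Spec Λ = B ⊆ T → Spec K` (`ptOver`, with its `K`-morphism `ptOverι` to `T`). For the
infinitesimal neighbourhoods of a fibre of `pr_T : P ×_K T → T` over `t ∈ B` one takes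
`R = 𝒪_{T,t}/𝔪_t^{n+1}` (Görtz–Wedhorn II, Lemma 24.72, proof, and Thm. 24.42: the schemes
`X_A = X ×_S Spec A`, `A` a local Artinian quotient of `𝒪_{S,s}`). This file records, with Mathlib
primitives only:

* `isPullback_whiskerLeft`: for any `K`-morphism `h : S' → T` the square
  `P ×_K S' → S'`, `P ×_K S' → P ×_K T → T` is cartesian (`P ×_K S' = (P ×_K T) ×_T S'`);
* `OpenOver f B` — opens `V` of the source of `f : X → S` lying over the open `B ⊆ S`, with the
  `Γ(B, 𝒪_S)`-algebra `OpenOver.Sec V = Γ(V, 𝒪_X)` (structure map `f^♯`), restriction and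
  pullback maps as algebra homomorphisms;
* **the model isomorphism** `OpenOver.modelEquiv`: for `V ⊆ pr_T⁻¹B` affine,
  `Γ(V, 𝒪_{P × T}) ⊗_Λ R ≃ₐ[Λ] Γ(ι_R⁻¹V, 𝒪_{P × Spec R})`, `c ⊗ r ↦ ι_R^*(c) · pr^*(r)`
  (`OpenOver.modelHom`, `modelHom_bijective`), where `ι_R : P ×_K Spec R → P ×_K T` is
  `P ◁ modelPtι` (affine base change of sections: Mathlib `isIso_pushoutSection_of_isAffineOpen`,
  Stacks Project Tag 02KH, applied to the cartesian square above, with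
  `CommRingCat.isPushout_tensorProduct` and `Scheme.ΓSpecIso`).

Its naturality in `V` (restriction), in `R` (transition maps `P × Spec R' → P × Spec R`) and in
`P` (slices `P' → P`) is in the sibling file `Motives/ThickeningModelNaturality`.

This is the bookkeeping by which Step (I) of the proof of Görtz–Wedhorn II, Lemma 24.72 ("As `𝓔`
is flat over `S` we obtain an exact sequence `0 → 𝓔_{|X_s} → 𝓔_{|X_A} → 𝓔_{|X_{A₀}} → 0`") is
reduced, on affine pieces, to the exactness of `Γ(V) ⊗_Λ (0 → I → A → A₀ → 0)` for the flat
`Λ`-algebra `Γ(V)`. Mathlib searched (pin): `pushoutSection`, `isIso_pushoutSection_iff`,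
`isIso_pushoutSection_of_isAffineOpen`, `CommRingCat.isPushout_tensorProduct`,
`IsPushout.isoIsPushout`, `Scheme.ΓSpecIso_naturality`, `IsAffineOpen.fromSpec_app_of_le`,
`Over.whiskerLeft_left` (used); Mathlib has no named statement "`Γ` of a base change to an affine
scheme is the tensor product" beyond `pushoutSection`.

## References

* U. Görtz, T. Wedhorn, *Algebraic Geometry II: Cohomology of Schemes*, Springer Spektrum (2023),
  doi:10.1007/978-3-658-43031-3: Lemma 24.72, proof, Step (I), p. 548. [GortzWedhorn2023]
* The Stacks Project, Tag 02KH (flat base change; affine base change of sections). [StacksProject]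
-/

universe u

open CategoryTheory CategoryTheory.Limits AlgebraicGeometry MonoidalCategory
open CartesianMonoidalCategory TensorProduct

noncomputable section

namespace Literature.AlgebraicGeometry.Motives

variable {K : Type u} [Field K]

/-! ### The cartesian square of `P ◁ h` -/

/-- **`P ×_K S' = (P ×_K T) ×_T S'`**: for a `K`-morphism `h : S' → T` the square with top
`P ×_K S' → S'`, left `P ◁ h : P ×_K S' → P ×_K T`, right `h` and bottom `pr_T` is cartesian
(pasting of the two product squares). [folklore] -/
theorem isPullback_whiskerLeft (P : SchemeOver K) {S' T : SchemeOver K} (h : S' ⟶ T) :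
    IsPullback (P ◁ h).left (snd P S').left (snd P T).left h.left := by
  have hT : IsPullback (fst P T).left (snd P T).left P.hom T.hom := IsPullback.of_hasPullback _ _
  have hS : IsPullback (fst P S').left (snd P S').left P.hom S'.hom :=
    IsPullback.of_hasPullback _ _
  refine IsPullback.of_right ?_ ?_ hT
  · have e1 : (P ◁ h).left ≫ (fst P T).left = (fst P S').left := by
      rw [← Over.comp_left, whiskerLeft_fst]
    have e2 : h.left ≫ T.hom = S'.hom := Over.w h
    rw [e1, e2]
    exact hS
  · rw [← Over.comp_left, whiskerLeft_snd, Over.comp_left]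

/-! ### `Spec R → T` as a `K`-scheme -/

section PtOver

variable (T : SchemeOver K)

/-- The `K`-scheme `Spec R → T → Spec K` attached to a morphism `q : Spec R → T` (e.g.
`Spec(𝒪_{T,t}/𝔪^{n+1}) → T`, `Spec κ(t) → T`). [folklore] -/
def ptOver {R : CommRingCat.{u}} (q : Spec R ⟶ T.left) : SchemeOver K :=
  Over.mk (q ≫ T.hom)

/-- The structure `K`-morphism `ptOver T q → T`. [folklore] -/
def ptOverι {R : CommRingCat.{u}} (q : Spec R ⟶ T.left) : ptOver T q ⟶ T :=
  Over.homMk q rfl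

/-- The scheme underlying `ptOver T q` is `Spec R`. [folklore] -/
@[simp] theorem ptOver_left {R : CommRingCat.{u}} (q : Spec R ⟶ T.left) :
    (ptOver T q).left = Spec R := rfl

/-- The structure morphism of `ptOver T q`. [folklore] -/
@[simp] theorem ptOver_hom {R : CommRingCat.{u}} (q : Spec R ⟶ T.left) :
    (ptOver T q).hom = q ≫ T.hom := rfl

/-- The scheme morphism underlying `ptOverι T q` is `q`. [folklore] -/
@[simp] theorem ptOverι_left {R : CommRingCat.{u}} (q : Spec R ⟶ T.left) :
    (ptOverι T q).left = q := rfl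

/-- Functoriality in `R`: a ring map `ψ : R → R'` gives `ptOver T (Spec ψ ≫ q) → ptOver T q` over
`T` (e.g. the closed immersions `Spec(𝒪/𝔪^{n+1}) → Spec(𝒪/𝔪^{n+2})`). [folklore] -/
def ptOverMap {R R' : CommRingCat.{u}} (q : Spec R ⟶ T.left) (ψ : R ⟶ R') :
    ptOver T (Spec.map ψ ≫ q) ⟶ ptOver T q :=
  Over.homMk (Spec.map ψ) (Category.assoc _ _ _).symm

/-- The scheme morphism underlying `ptOverMap T q ψ` is `Spec ψ`. [folklore] -/
@[simp] theorem ptOverMap_left {R R' : CommRingCat.{u}} (q : Spec R ⟶ T.left) (ψ : R ⟶ R') :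
    (ptOverMap T q ψ).left = Spec.map ψ := rfl

/-- `ptOverMap` is a morphism over `T`. [folklore] -/
@[simp] theorem ptOverMap_ι {R R' : CommRingCat.{u}} (q : Spec R ⟶ T.left) (ψ : R ⟶ R') :
    ptOverMap T q ψ ≫ ptOverι T q = ptOverι T (Spec.map ψ ≫ q) := by
  ext : 1
  simp [ptOverMap, ptOverι]

end PtOver

/-! ### Opens over an open of the base and their rings of sections -/

/-- An open `V` of the source of `f : X → S` lying over the open `B ⊆ S` (`V ⊆ f⁻¹B`), so that
`Γ(V, 𝒪_X)` is a `Γ(B, 𝒪_S)`-algebra through `f^♯`. [folklore] -/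
structure OpenOver {X S : Scheme.{u}} (f : X ⟶ S) (B : S.Opens) where
  /-- The open subset. -/
  U : X.Opens
  /-- It lies over `B`. -/
  le : U ≤ f ⁻¹ᵁ B

namespace OpenOver

variable {X S : Scheme.{u}} {f : X ⟶ S} {B : S.Opens}

/-- Two opens over `B` with the same underlying open are equal. [folklore] -/
@[ext] theorem ext {V W : OpenOver f B} (h : V.U = W.U) : V = W := by
  cases V; cases W; congr

/-- The ring of sections `Γ(V, 𝒪_X)` of an open over `B` (a type synonym carrying the
`Γ(B, 𝒪_S)`-algebra structure `f^♯ : Γ(B, 𝒪_S) → Γ(V, 𝒪_X)`). [folklore] -/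
def Sec (V : OpenOver f B) : Type u := Γ(X, V.U)

variable (V W : OpenOver f B)

/-- The ring structure of `Γ(V, 𝒪_X)`. [folklore] -/
instance : CommRing V.Sec := inferInstanceAs (CommRing Γ(X, V.U))

/-- `Γ(V, 𝒪_X)` as a `Γ(B, 𝒪_S)`-algebra through `f^♯` (Mathlib `Scheme.Hom.appLE`). [folklore] -/
instance algebra : Algebra Γ(S, B) V.Sec := (f.appLE B V.U V.le).hom.toAlgebra

/-- The structure map of `Γ(V, 𝒪_X)` is `f^♯ : Γ(B, 𝒪_S) → Γ(V, 𝒪_X)`. [folklore] -/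
theorem algebraMap_eq : algebraMap Γ(S, B) V.Sec = (f.appLE B V.U V.le).hom := rfl

/-- The identification `V.Sec = Γ(V, 𝒪_X)` as a ring isomorphism. [folklore] -/
def secEquiv : V.Sec ≃+* Γ(X, V.U) := RingEquiv.refl _

/-- The intersection of two opens over `B`. [folklore] -/
def inf : OpenOver f B := ⟨V.U ⊓ W.U, inf_le_left.trans V.le⟩

/-- The underlying open of `V.inf W`. [folklore] -/
@[simp] theorem inf_U : (V.inf W).U = V.U ⊓ W.U := rfl

variable {V W}

/-- **Restriction** `Γ(V, 𝒪_X) → Γ(W, 𝒪_X)` for `W ⊆ V`, a `Γ(B, 𝒪_S)`-algebra homomorphism.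
[folklore] -/
def res (h : W.U ≤ V.U) : V.Sec →ₐ[Γ(S, B)] W.Sec :=
  { (X.presheaf.map (homOfLE h).op).hom with
    commutes' := fun a => by
      change (f.appLE B V.U V.le ≫ X.presheaf.map (homOfLE h).op) a = f.appLE B W.U W.le a
      rw [Scheme.Hom.appLE_map] }

/-- `res` is the restriction map of `𝒪_X`. [folklore] -/
theorem res_apply (h : W.U ≤ V.U) (s : V.Sec) : res h s = X.presheaf.map (homOfLE h).op s := rfl

/-- Restricting to the same open is the identity. [folklore] -/
@[simp] theorem res_self (s : V.Sec) : res (le_refl V.U) s = s := by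
  have : (homOfLE (le_refl V.U)).op = 𝟙 (Opposite.op V.U) := Subsingleton.elim _ _
  rw [res_apply, this, X.presheaf.map_id]
  rfl

/-- Restriction is transitive. [folklore] -/
@[simp] theorem res_res {W' : OpenOver f B} (h : W.U ≤ V.U) (h' : W'.U ≤ W.U) (s : V.Sec) :
    res h' (res h s) = res (h'.trans h) s := by
  change (X.presheaf.map (homOfLE h).op ≫ X.presheaf.map (homOfLE h').op) s = _
  rw [← Functor.map_comp]
  rfl

/-! #### Pullback along a morphism over `S` -/

variable {X' : Scheme.{u}} {f' : X' ⟶ S} (g : X' ⟶ X) (hg : g ≫ f = f')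

/-- The preimage of an open over `B` under a morphism `g` over `S` is an open over `B`.
[folklore] -/
def preimage (V : OpenOver f B) : OpenOver f' B :=
  ⟨g ⁻¹ᵁ V.U, by rw [← hg]; exact fun x hx => V.le hx⟩

/-- The underlying open of the preimage. [folklore] -/
@[simp] theorem preimage_U (V : OpenOver f B) : (V.preimage g hg).U = g ⁻¹ᵁ V.U := rfl

include hg in
/-- `g^*` is compatible with the structure maps: `g^*(f^♯ a) = f'^♯ a`. [folklore] -/
theorem appLE_algebraMap (V : OpenOver f B) (W : OpenOver f' B) (e : W.U ≤ g ⁻¹ᵁ V.U)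
    (a : Γ(S, B)) : g.appLE V.U W.U e (algebraMap Γ(S, B) V.Sec a) = algebraMap Γ(S, B) W.Sec a := by
  change (f.appLE B V.U V.le ≫ g.appLE V.U W.U e) a = f'.appLE B W.U W.le a
  rw [Scheme.Hom.appLE_comp_appLE]
  subst hg
  rfl

/-- **Pullback of sections** `g^* : Γ(V, 𝒪_X) → Γ(W, 𝒪_{X'})` for `W ⊆ g⁻¹V`, along a morphism `g`
over `S`, a `Γ(B, 𝒪_S)`-algebra homomorphism (Mathlib `Scheme.Hom.appLE`). [folklore] -/
def comap (V : OpenOver f B) (W : OpenOver f' B) (e : W.U ≤ g ⁻¹ᵁ V.U) :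
    V.Sec →ₐ[Γ(S, B)] W.Sec :=
  { (g.appLE V.U W.U e).hom with commutes' := appLE_algebraMap g hg V W e }

/-- `comap` is `appLE`. [folklore] -/
theorem comap_apply (V : OpenOver f B) (W : OpenOver f' B) (e : W.U ≤ g ⁻¹ᵁ V.U) (s : V.Sec) :
    comap g hg V W e s = g.appLE V.U W.U e s := rfl

/-- Pullback then restriction. [folklore] -/
theorem res_comap (V : OpenOver f B) {W W' : OpenOver f' B} (e : W.U ≤ g ⁻¹ᵁ V.U)
    (h : W'.U ≤ W.U) (s : V.Sec) :
    res h (comap g hg V W e s) = comap g hg V W' (h.trans e) s := by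
  rw [res_apply, comap_apply, comap_apply, ← CommRingCat.comp_apply, Scheme.Hom.appLE_map]

/-- Restriction then pullback. [folklore] -/
theorem comap_res {V V' : OpenOver f B} (W : OpenOver f' B) (h : V'.U ≤ V.U)
    (e : W.U ≤ g ⁻¹ᵁ V'.U) (s : V.Sec) :
    comap g hg V' W e (res h s) = comap g hg V W (e.trans (g.preimage_mono h)) s := by
  rw [res_apply, comap_apply, comap_apply, ← CommRingCat.comp_apply, Scheme.Hom.map_appLE]

end OpenOver

/-! ### The model isomorphism `Γ(V) ⊗_Λ R ≅ Γ(ι_R⁻¹V)` -/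

section Model

variable (T : SchemeOver K) {B : T.left.Opens} (hB : IsAffineOpen B)
  (R : Type u) [CommRing R] [Algebra Γ(T.left, B) R]

/-- The morphism `Spec R → Spec Γ(B, 𝒪_T) = B ⊆ T` of a `Γ(B, 𝒪_T)`-algebra `R`. [folklore] -/
def baseSpec : Spec (.of R) ⟶ T.left :=
  Spec.map (CommRingCat.ofHom (algebraMap Γ(T.left, B) R)) ≫ hB.fromSpec

/-- The infinitesimal model base `Spec R → T → Spec K` as a `K`-scheme (`ptOver` of `baseSpec`);
`P ⊗ modelPt T hB R = P ×_K Spec R`. [folklore] -/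
abbrev modelPt : SchemeOver K := ptOver T (baseSpec T hB R)

/-- Its structure morphism `Spec R → T` over `K`. [folklore] -/
abbrev modelPtι : modelPt T hB R ⟶ T := ptOverι T (baseSpec T hB R)

/-- `Spec R` is affine (instance for the scheme underlying `modelPt T hB R`). [folklore] -/
instance isAffine_modelPt_left : IsAffine (modelPt T hB R).left :=
  inferInstanceAs (IsAffine (Spec (.of R)))

/-- `Spec R → T` lands in `B`: the preimage of `B` is everything. [folklore] -/
theorem modelPtι_preimage : (modelPtι T hB R).left ⁻¹ᵁ B = ⊤ := by
  change (Spec.map _ ≫ hB.fromSpec) ⁻¹ᵁ B = ⊤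
  rw [Scheme.Hom.comp_preimage, hB.fromSpec_preimage_self]
  rfl

/-- `⊤ ≤ (Spec R → T)⁻¹ B`. [folklore] -/
theorem top_le_modelPtι_preimage :
    (⊤ : (modelPt T hB R).left.Opens) ≤ (modelPtι T hB R).left ⁻¹ᵁ B :=
  (modelPtι_preimage T hB R).ge

/-- **On functions, `Spec R → B` is the structure map `Γ(B, 𝒪_T) → R`** (up to
`Γ(Spec R, 𝒪) = R`, Mathlib `Scheme.ΓSpecIso`). [folklore] -/
theorem modelPtι_appLE_ΓSpecIso_hom :
    (modelPtι T hB R).left.appLE B ⊤ (top_le_modelPtι_preimage T hB R) ≫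
        (Scheme.ΓSpecIso (.of R)).hom =
      CommRingCat.ofHom (algebraMap Γ(T.left, B) R) := by
  set φ : Γ(T.left, B) ⟶ CommRingCat.of R := CommRingCat.ofHom (algebraMap Γ(T.left, B) R)
  have e₁ : (⊤ : (Spec Γ(T.left, B)).Opens) ≤ hB.fromSpec ⁻¹ᵁ B := by
    rw [hB.fromSpec_preimage_self]
  have h1 : hB.fromSpec.appLE B ⊤ e₁ = (Scheme.ΓSpecIso Γ(T.left, B)).inv := by
    rw [Scheme.Hom.appLE, hB.fromSpec_app_self, Category.assoc, ← CategoryTheory.Functor.map_comp]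
    have : ((eqToHom hB.fromSpec_preimage_self).op ≫ (homOfLE e₁).op :
        Opposite.op ⊤ ⟶ Opposite.op ⊤) = 𝟙 _ := Subsingleton.elim _ _
    rw [this, CategoryTheory.Functor.map_id, Category.comp_id]
  have h2 : (Spec.map φ).appLE ⊤ ⊤ le_rfl = (Spec.map φ).appTop := Scheme.Hom.appLE_eq_app _
  have h3 : (modelPtι T hB R).left.appLE B ⊤ (top_le_modelPtι_preimage T hB R) =
      hB.fromSpec.appLE B ⊤ e₁ ≫ (Spec.map φ).appLE ⊤ ⊤ le_rfl :=
    (Scheme.Hom.appLE_comp_appLE _ _ _ _ _ _ _).symm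
  rw [h3, h1, h2]
  have key : ((Scheme.ΓSpecIso Γ(T.left, B)).inv ≫ (Spec.map φ).appTop) ≫
      (Scheme.ΓSpecIso (.of R)).hom = φ := by
    rw [Category.assoc, Scheme.ΓSpecIso_naturality, Iso.inv_hom_id_assoc]
  exact key

variable (P : SchemeOver K)

/-- `ι_R : P ×_K Spec R → P ×_K T` is a morphism over `T`. [folklore] -/
theorem whiskerLeft_modelPtι_snd :
    (P ◁ modelPtι T hB R).left ≫ (snd P T).left =
      (snd P (modelPt T hB R)).left ≫ (modelPtι T hB R).left := by
  rw [← Over.comp_left, whiskerLeft_snd, Over.comp_left]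

variable {T P}

namespace OpenOver

variable (V : OpenOver (snd P T).left B)

/-- The preimage `ι_R⁻¹V ⊆ P ×_K Spec R` of an open `V ⊆ pr_T⁻¹B`, an open over `B`. [folklore] -/
abbrev thick : OpenOver ((snd P (modelPt T hB R)).left ≫ (modelPtι T hB R).left) B :=
  V.preimage (P ◁ modelPtι T hB R).left (whiskerLeft_modelPtι_snd T hB R P)

/-- `ι_R^* : Γ(V) → Γ(ι_R⁻¹V)` as a `Γ(B, 𝒪_T)`-algebra homomorphism. [folklore] -/
abbrev thickComap : V.Sec →ₐ[Γ(T.left, B)] (V.thick hB R).Sec :=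
  V.comap (P ◁ modelPtι T hB R).left (whiskerLeft_modelPtι_snd T hB R P) (V.thick hB R) le_rfl

/-- `pr^* : R = Γ(Spec R, 𝒪) → Γ(ι_R⁻¹V)` (through Mathlib `Scheme.ΓSpecIso`). [folklore] -/
def thickConst : R →+* (V.thick hB R).Sec :=
  ((snd P (modelPt T hB R)).left.appLE ⊤ (V.thick hB R).U le_top).hom.comp
    (Scheme.ΓSpecIso (.of R)).inv.hom

/-- Unfolding of `thickConst`. [folklore] -/
theorem thickConst_apply (r : R) : V.thickConst hB R r =
    (snd P (modelPt T hB R)).left.appLE ⊤ (V.thick hB R).U le_top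
      ((Scheme.ΓSpecIso (.of R)).inv r) := rfl

/-- `pr^*` is a `Γ(B, 𝒪_T)`-algebra homomorphism. [folklore] -/
theorem thickConst_algebraMap (a : Γ(T.left, B)) :
    V.thickConst hB R (algebraMap Γ(T.left, B) R a) =
      algebraMap Γ(T.left, B) (V.thick hB R).Sec a := by
  have h := modelPtι_appLE_ΓSpecIso_hom T hB R
  rw [← Iso.eq_comp_inv] at h
  have h' : V.thickConst hB R (algebraMap Γ(T.left, B) R a) =
      ((modelPtι T hB R).left.appLE B ⊤ (top_le_modelPtι_preimage T hB R) ≫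
        (snd P (modelPt T hB R)).left.appLE ⊤ (V.thick hB R).U le_top) a := by
    rw [h]; rfl
  rw [h', Scheme.Hom.appLE_comp_appLE]
  rfl

/-- `pr^*` as a `Γ(B, 𝒪_T)`-algebra homomorphism. [folklore] -/
def thickConstAlgHom : R →ₐ[Γ(T.left, B)] (V.thick hB R).Sec :=
  { V.thickConst hB R with commutes' := V.thickConst_algebraMap hB R }

/-- `thickConstAlgHom` is `thickConst`. [folklore] -/
@[simp] theorem thickConstAlgHom_apply (r : R) :
    V.thickConstAlgHom hB R r = V.thickConst hB R r := rfl

/-- **The model map** `Γ(V) ⊗_Λ R → Γ(ι_R⁻¹V)`, `c ⊗ r ↦ ι_R^*(c) · pr^*(r)`. [folklore] -/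
def modelHom : V.Sec ⊗[Γ(T.left, B)] R →ₐ[Γ(T.left, B)] (V.thick hB R).Sec :=
  Algebra.TensorProduct.productMap (V.thickComap hB R) (V.thickConstAlgHom hB R)

/-- The model map on pure tensors. [folklore] -/
@[simp] theorem modelHom_tmul (c : V.Sec) (r : R) :
    V.modelHom hB R (c ⊗ₜ r) = V.thickComap hB R c * V.thickConst hB R r :=
  Algebra.TensorProduct.productMap_apply_tmul _ _ _ _

/-- **Sections of a base change, as a pushout** (Mathlib `isIso_pushoutSection_of_isAffineOpen`,
Stacks Project Tag 02KH, for the cartesian square `P × Spec R → Spec R`, `P × T → T` and the affine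
opens `B`, `Spec R`, `V`): `Γ(ι_R⁻¹V)` is the pushout of `Γ(V) ← Γ(B) → Γ(Spec R)`.
[cite: StacksProject, Tag 02KH] -/
theorem isPushout_thick (hV : IsAffineOpen V.U) :
    IsPushout ((snd P T).left.appLE B V.U V.le)
      ((modelPtι T hB R).left.appLE B ⊤ (top_le_modelPtι_preimage T hB R))
      ((P ◁ modelPtι T hB R).left.appLE V.U (V.thick hB R).U le_rfl)
      ((snd P (modelPt T hB R)).left.appLE ⊤ (V.thick hB R).U le_top) := by
  have H := isPullback_whiskerLeft P (modelPtι T hB R)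
  have hUY : (V.thick hB R).U = (P ◁ modelPtι T hB R).left ⁻¹ᵁ V.U ⊓
      (snd P (modelPt T hB R)).left ⁻¹ᵁ ⊤ := (inf_top_eq _).symm
  have hiso := isIso_pushoutSection_of_isAffineOpen H (top_le_modelPtι_preimage T hB R) V.le hUY
    hB (isAffineOpen_top _) hV
  exact (isIso_pushoutSection_iff H (top_le_modelPtι_preimage T hB R) V.le hUY).mp hiso

/-- The same pushout with the corner `Γ(Spec R, 𝒪)` replaced by `R` along `Scheme.ΓSpecIso`.
[folklore] -/
theorem isPushout_thick_R (hV : IsAffineOpen V.U) :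
    IsPushout ((snd P T).left.appLE B V.U V.le)
      (CommRingCat.ofHom (algebraMap Γ(T.left, B) R))
      ((P ◁ modelPtι T hB R).left.appLE V.U (V.thick hB R).U le_rfl)
      ((Scheme.ΓSpecIso (.of R)).inv ≫
        (snd P (modelPt T hB R)).left.appLE ⊤ (V.thick hB R).U le_top) := by
  rw [← modelPtι_appLE_ΓSpecIso_hom T hB R]
  exact (V.isPushout_thick hB R hV).of_iso (Iso.refl _) (Iso.refl _) (Scheme.ΓSpecIso (.of R))
    (Iso.refl _) (by simp) (by simp) (by simp)
    (by
      rw [Iso.refl_hom, Category.comp_id]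
      exact ((Scheme.ΓSpecIso (.of R)).hom_inv_id_assoc _).symm)

/-- The same pushout, all objects in the form `CommRingCat.of _` and all maps `CommRingCat.ofHom _`
(definitionally equal to `isPushout_thick_R`). [folklore] -/
theorem isPushout_thick' (hV : IsAffineOpen V.U) :
    IsPushout (CommRingCat.ofHom (algebraMap Γ(T.left, B) V.Sec))
      (CommRingCat.ofHom (algebraMap Γ(T.left, B) R))
      (CommRingCat.ofHom (V.thickComap hB R).toRingHom)
      (CommRingCat.ofHom (V.thickConst hB R)) :=
  V.isPushout_thick_R hB R hV

/-- **The model isomorphism `Γ(V) ⊗_Λ R ≅ Γ(ι_R⁻¹V)`** in `CommRingCat`, from the two pushout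
squares (`CommRingCat.isPushout_tensorProduct` and `isPushout_thick'`). [folklore] -/
def modelIso (hV : IsAffineOpen V.U) :
    CommRingCat.of (V.Sec ⊗[Γ(T.left, B)] R) ≅ CommRingCat.of (V.thick hB R).Sec :=
  (CommRingCat.isPushout_tensorProduct Γ(T.left, B) V.Sec R).isoIsPushout _ _
    (V.isPushout_thick' hB R hV)

/-- The model isomorphism is the model map. [folklore] -/
theorem modelIso_hom_apply (hV : IsAffineOpen V.U) (x : V.Sec ⊗[Γ(T.left, B)] R) :
    (V.modelIso hB R hV).hom x = V.modelHom hB R x := by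
  induction x using TensorProduct.induction_on with
  | zero => simp only [map_zero]
  | add x y hx hy => simp only [map_add, hx, hy]
  | tmul c r =>
    have h1 : (V.modelIso hB R hV).hom (c ⊗ₜ (1 : R)) = V.thickComap hB R c :=
      ConcreteCategory.congr_hom
        ((CommRingCat.isPushout_tensorProduct Γ(T.left, B) V.Sec R).inl_isoIsPushout_hom _ _
          (V.isPushout_thick' hB R hV)) c
    have h2 : (V.modelIso hB R hV).hom ((1 : V.Sec) ⊗ₜ r) = V.thickConst hB R r :=
      ConcreteCategory.congr_hom
        ((CommRingCat.isPushout_tensorProduct Γ(T.left, B) V.Sec R).inr_isoIsPushout_hom _ _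
          (V.isPushout_thick' hB R hV)) r
    have e : (c ⊗ₜ[Γ(T.left, B)] r : V.Sec ⊗[Γ(T.left, B)] R) = (c ⊗ₜ 1) * (1 ⊗ₜ r) := by
      rw [Algebra.TensorProduct.tmul_mul_tmul, mul_one, one_mul]
    rw [e, map_mul, h1, h2, ← e, modelHom_tmul]

/-- **The model map `Γ(V) ⊗_Λ R → Γ(ι_R⁻¹V)` is bijective** for `V` affine. [folklore] -/
theorem modelHom_bijective (hV : IsAffineOpen V.U) : Function.Bijective (V.modelHom hB R) := by
  obtain ⟨hi, hs⟩ := ConcreteCategory.bijective_of_isIso (V.modelIso hB R hV).hom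
  refine ⟨fun x y hxy => hi ?_, fun z => ?_⟩
  · change (V.modelIso hB R hV).hom x = (V.modelIso hB R hV).hom y
    rwa [modelIso_hom_apply, modelIso_hom_apply]
  · obtain ⟨x, hx⟩ := hs z
    exact ⟨x, (V.modelIso_hom_apply hB R hV x).symm.trans hx⟩

/-- **The model isomorphism** `Γ(V, 𝒪_{P × T}) ⊗_{Γ(B)} R ≃ₐ Γ(ι_R⁻¹V, 𝒪_{P × Spec R})`,
`c ⊗ r ↦ ι_R^*(c) · pr^*(r)`, for `V ⊆ pr_T⁻¹B` affine. [cite: StacksProject, Tag 02KH] -/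
def modelEquiv (hV : IsAffineOpen V.U) :
    V.Sec ⊗[Γ(T.left, B)] R ≃ₐ[Γ(T.left, B)] (V.thick hB R).Sec :=
  AlgEquiv.ofBijective (V.modelHom hB R) (V.modelHom_bijective hB R hV)

/-- `modelEquiv` is `modelHom`. [folklore] -/
@[simp] theorem modelEquiv_apply (hV : IsAffineOpen V.U) (x : V.Sec ⊗[Γ(T.left, B)] R) :
    V.modelEquiv hB R hV x = V.modelHom hB R x := rfl

end OpenOver

end Model

end Literature.AlgebraicGeometry.Motives

end
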